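import Mathlib.RingTheory.Polynomial.IntegralNormalization
import Mathlib.RingTheory.Polynomial.ScaleRoots
import Mathlib.Algebra.Polynomial.Div
import Mathlib.Algebra.Polynomial.EraseLead
import Mathlib.Algebra.Polynomial.Derivative
import Mathlib.Data.Sign.Basic
import Literature.FieldTheory.RealClosed.Polynomial
import Literature.ModelTheory.ExponentialFields.SignDiagram
import HarnessLib

/-!
# Sign diagrams of stable families over real closed fields (two-field version)

This file generalizes the univariate and the parametric part of
`Literature/ModelTheory/ExponentialFields/SignDiagram.lean` (Cohen–Hörmander elimination over `ℝ`,
used there for the Tarski–Seidenberg projection theorem over `ℝ`) from `ℝ` to arbitrary real closed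
fields, and from one field to a *pair* of real closed fields `K`, `L`:

* the interval and gap lemmas for one polynomial / one finite family over a real closed field `K`
  (`exists_root_Ioo_iff`, `exists_frame`, `exists_root_gap_iff`, `sign_gap_of_root`, …), now
  resting on the algebraic intermediate value property, Rolle's theorem and monotonicity over real
  closed fields (`Literature.FieldTheory.RealClosed.exists_root_of_neg_of_pos`,
  `Literature.FieldTheory.RealClosed.strictMonoOn_or_strictAntiOn`,
  `Literature.FieldTheory.RealClosed.exists_forall_le_sign_eval_eq`) instead of real analysis;
* correspondences `e : K → L` between the root set of a finite family over `K` and the root set of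
  a finite family over `L` (`IsCorrespondence`, `IsoDiag`) and the extension theorem
  `IsCorrespondence.isoDiag_insert`;
* the **parametric sign-diagram theorem for two real closed fields** `isoDiag_specPairs`: for a
  finite stable family `P ⊆ A[X]` (`Literature.ModelTheory.ExponentialFields.SignDiagram.IsStable`,
  reused from the one-field file together with the scaled pseudo-remainder `sprem` and the
  existence of stable closures) and ring homomorphisms `φ : A → K`, `ψ : A → L` into two real
  closed fields giving the same signs to all coefficients of members of `P`, the specialized
  families have isomorphic sign diagrams; hence the same simultaneous sign conditions on `P` are
  realizable over `K` (at some point of `K`) and over `L` (`exists_forall_sign_eval_map_eq`).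

The last statement is the combinatorial heart of Tarski's transfer principle "every real closed
field is elementarily equivalent to `ℝ`" (Basu–Pollack–Roy 2006, Thm. 2.80; proved from it in
`Literature/ModelTheory/ExponentialFields/RealExpFieldProofs.lean`): it says that one existential
quantifier over a stable family can be decided from the signs of finitely many polynomials in the
parameters, *uniformly in the real closed field*.

The proofs are those of the one-field file, verbatim up to the replacement of `ℝ` by `K`, `L`;
see that file for the mathematical commentary (Basu–Pollack–Roy 2006, §1.3, Lemma 5.33 (Thom's
lemma), Lemma 2.74, Thm. 2.76; Bochnak–Coste–Roy 1998, Thm. 2.2.1; Cohen 1969).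

## References

* S. Basu, R. Pollack, M.-F. Roy, *Algorithms in Real Algebraic Geometry*, 2nd ed., Springer
  (2006): §1.3, §2.1 (Prop. 2.4, Thm. 2.11, Prop. 2.20–Cor. 2.24), Lemma 5.33, Lemma 2.74,
  Thm. 2.76, Thm. 2.80.
* J. Bochnak, M. Coste, M.-F. Roy, *Real Algebraic Geometry*, Ergebnisse 36, Springer (1998),
  Thm. 2.2.1, Prop. 5.2.3.
* P. J. Cohen, Decision procedures for real and `p`-adic fields, Comm. Pure Appl. Math. 22
  (1969), 131–151.
-/

noncomputable section

open Polynomial Set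
open Literature.FieldTheory.RealClosed

namespace Literature.ModelTheory.ExponentialFields

namespace SignDiagramRCF

/-! ### Signs at `±∞` -/

section Interval

variable {K : Type*} [Field K] [LinearOrder K] [IsStrictOrderedRing K]

/-- The sign of a polynomial near `+∞`: the sign of its leading coefficient. [folklore] -/
def signTop (p : K[X]) : SignType := SignType.sign p.leadingCoeff

/-- The sign of a polynomial near `-∞`: `(-1)^(deg p)` times the sign of its leading
coefficient. [folklore] -/
def signBot (p : K[X]) : SignType :=
  if Even p.natDegree then SignType.sign p.leadingCoeff else -SignType.sign p.leadingCoeff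

variable [IsRealClosed K]

/-! ### One polynomial on one closed interval over a real closed field -/

variable {p : K[X]} {a b : K}

/-- **Interval lemma, root existence.** For a polynomial strictly monotone or antitone on
`[a, b]`, there is a root in `(a, b)` iff the signs at the endpoints are non-zero and opposite.
[folklore] -/
theorem exists_root_Ioo_iff (hab : a < b)
    (hmono : StrictMonoOn (fun x => p.eval x) (Icc a b) ∨
      StrictAntiOn (fun x => p.eval x) (Icc a b)) :
    (∃ r ∈ Ioo a b, p.eval r = 0) ↔
      (SignType.sign (p.eval a) = -SignType.sign (p.eval b) ∧ SignType.sign (p.eval a) ≠ 0) := by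
  have haI : a ∈ Icc a b := left_mem_Icc.mpr hab.le
  have hbI : b ∈ Icc a b := right_mem_Icc.mpr hab.le
  constructor
  · rintro ⟨r, hr, hr0⟩
    have hrI : r ∈ Icc a b := Ioo_subset_Icc_self hr
    rcases hmono with hmono | hmono
    · have h1 : p.eval a < p.eval r := hmono haI hrI hr.1
      have h2 : p.eval r < p.eval b := hmono hrI hbI hr.2
      rw [hr0] at h1 h2
      simp [sign_neg h1, sign_pos h2]
    · have h1 : p.eval r < p.eval a := hmono haI hrI hr.1
      have h2 : p.eval b < p.eval r := hmono hrI hbI hr.2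
      rw [hr0] at h1 h2
      simp [sign_pos h1, sign_neg h2]
  · rintro ⟨hopp, hne⟩
    have ha0 : p.eval a ≠ 0 := fun h => hne (by rw [h, sign_zero])
    rcases lt_or_gt_of_ne ha0 with ha' | ha'
    · rw [sign_neg ha'] at hopp
      have hb' : 0 < p.eval b := sign_eq_one_iff.mp (by
        rcases lt_trichotomy (p.eval b) 0 with h | h | h
        · rw [sign_neg h] at hopp; exact absurd hopp (by decide)
        · rw [h, sign_zero] at hopp; exact absurd hopp (by decide)
        · exact sign_pos h)
      exact exists_root_of_neg_of_pos hab.le ha' hb'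
    · rw [sign_pos ha'] at hopp
      have hb' : p.eval b < 0 := sign_eq_neg_one_iff.mp (by
        rcases lt_trichotomy (p.eval b) 0 with h | h | h
        · exact sign_neg h
        · rw [h, sign_zero] at hopp; exact absurd hopp (by decide)
        · rw [sign_pos h] at hopp; exact absurd hopp (by decide))
      exact exists_root_of_pos_of_neg hab.le ha' hb'

omit [IsStrictOrderedRing K] [IsRealClosed K] in
/-- **Interval lemma, uniqueness.** [folklore] -/
theorem root_unique (hmono : StrictMonoOn (fun x => p.eval x) (Icc a b) ∨
      StrictAntiOn (fun x => p.eval x) (Icc a b))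
    {r₁ r₂ : K} (h₁ : r₁ ∈ Icc a b) (h₂ : r₂ ∈ Icc a b) (hr₁ : p.eval r₁ = 0)
    (hr₂ : p.eval r₂ = 0) : r₁ = r₂ := by
  rcases hmono with hmono | hmono
  · exact hmono.injOn h₁ h₂ (hr₁.trans hr₂.symm)
  · exact hmono.injOn h₁ h₂ (hr₁.trans hr₂.symm)

omit [IsStrictOrderedRing K] [IsRealClosed K] in
/-- **Interval lemma, signs left and right of the root.** [folklore] -/
theorem sign_eq_of_root (hab : a < b)
    (hmono : StrictMonoOn (fun x => p.eval x) (Icc a b) ∨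
      StrictAntiOn (fun x => p.eval x) (Icc a b))
    {r y : K} (hr : r ∈ Ioo a b) (hr0 : p.eval r = 0) (hy : y ∈ Ioo a b) (hy0 : p.eval y ≠ 0) :
    SignType.sign (p.eval y) =
      if y < r then SignType.sign (p.eval a) else SignType.sign (p.eval b) := by
  have haI : a ∈ Icc a b := left_mem_Icc.mpr hab.le
  have hbI : b ∈ Icc a b := right_mem_Icc.mpr hab.le
  have hrI : r ∈ Icc a b := Ioo_subset_Icc_self hr
  have hyI : y ∈ Icc a b := Ioo_subset_Icc_self hy
  have hyr : y ≠ r := fun h => hy0 (h ▸ hr0)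
  rcases hmono with hmono | hmono
  · have h1 : p.eval a < p.eval r := hmono haI hrI hr.1
    have h2 : p.eval r < p.eval b := hmono hrI hbI hr.2
    rw [hr0] at h1 h2
    split_ifs with hlt
    · have : p.eval y < p.eval r := hmono hyI hrI hlt
      rw [hr0] at this
      rw [sign_neg this, sign_neg h1]
    · have hlt' : r < y := lt_of_le_of_ne (not_lt.mp hlt) hyr.symm
      have : p.eval r < p.eval y := hmono hrI hyI hlt'
      rw [hr0] at this
      rw [sign_pos this, sign_pos h2]
  · have h1 : p.eval r < p.eval a := hmono haI hrI hr.1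
    have h2 : p.eval b < p.eval r := hmono hrI hbI hr.2
    rw [hr0] at h1 h2
    split_ifs with hlt
    · have : p.eval r < p.eval y := hmono hyI hrI hlt
      rw [hr0] at this
      rw [sign_pos this, sign_pos h1]
    · have hlt' : r < y := lt_of_le_of_ne (not_lt.mp hlt) hyr.symm
      have : p.eval y < p.eval r := hmono hrI hyI hlt'
      rw [hr0] at this
      rw [sign_neg this, sign_neg h2]

/-- **Interval lemma, sign when there is no root.** [folklore] -/
theorem sign_eq_of_no_root (hab : a < b)
    (hmono : StrictMonoOn (fun x => p.eval x) (Icc a b) ∨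
      StrictAntiOn (fun x => p.eval x) (Icc a b))
    (hno : ∀ r ∈ Ioo a b, p.eval r ≠ 0) {y : K} (hy : y ∈ Ioo a b) :
    SignType.sign (p.eval y) =
      if SignType.sign (p.eval a) ≠ 0 then SignType.sign (p.eval a)
      else SignType.sign (p.eval b) := by
  have haI : a ∈ Icc a b := left_mem_Icc.mpr hab.le
  have hbI : b ∈ Icc a b := right_mem_Icc.mpr hab.le
  have hyI : y ∈ Icc a b := Ioo_subset_Icc_self hy
  -- no root on `[a, y]` except possibly at `a`, none on `[y, b]` except possibly at `b`
  split_ifs with ha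
  · -- sign at y equals sign at a: no root in `[a, y]`
    have ha0 : p.eval a ≠ 0 := sign_ne_zero.mp ha
    exact (sign_eq_sign_of_forall_ne_zero hy.1.le fun z hz => by
      rcases eq_or_lt_of_le hz.1 with h | h
      · exact h ▸ ha0
      · exact hno z ⟨h, hz.2.trans_lt hy.2⟩).symm
  · have ha0 : p.eval a = 0 := by simpa [sign_eq_zero_iff] using ha
    -- then `b` is not a root (strict monotonicity) and no root in `[y, b]`
    have hb0 : p.eval b ≠ 0 := by
      intro hb0
      have := root_unique hmono haI hbI ha0 hb0
      exact hab.ne this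
    exact sign_eq_sign_of_forall_ne_zero hy.2.le fun z hz => by
      rcases eq_or_lt_of_le hz.2 with h | h
      · exact h ▸ hb0
      · exact hno z ⟨hy.1.trans_le hz.1, h⟩

end Interval

/-! ### Root sets, gaps and endpoint signs of a finite family -/

section Family

variable {K : Type*} [Field K] [LinearOrder K] [IsStrictOrderedRing K]

/-- The set of real roots of the non-zero members of a finite family of real polynomials.
[folklore] -/
def rts (F : Finset K[X]) : Finset K := F.biUnion fun f => f.roots.toFinset

omit [IsStrictOrderedRing K] in
/-- Membership in the root set of a family. [folklore] -/
theorem mem_rts {F : Finset K[X]} {z : K} : z ∈ rts F ↔ ∃ f ∈ F, f ≠ 0 ∧ f.eval z = 0 := by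
  simp [rts, Multiset.mem_toFinset, mem_roots', IsRoot.def]

omit [IsStrictOrderedRing K] in
/-- The root set is monotone in the family. [folklore] -/
theorem rts_mono {F G : Finset K[X]} (h : F ⊆ G) : rts F ⊆ rts G := fun z hz => by
  obtain ⟨f, hf, hf0, hfz⟩ := mem_rts.mp hz
  exact mem_rts.mpr ⟨f, h hf, hf0, hfz⟩

/-- The roots of the family lying strictly below `y`. [folklore] -/
def below (F : Finset K[X]) (y : K) : Finset K := (rts F).filter (· < y)

/-- The roots of the family lying strictly above `y`. [folklore] -/
def above (F : Finset K[X]) (y : K) : Finset K := (rts F).filter (fun z => y < z)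

omit [IsStrictOrderedRing K] in
/-- Membership in `below`. [folklore] -/
theorem mem_below {F : Finset K[X]} {y z : K} : z ∈ below F y ↔ z ∈ rts F ∧ z < y := by
  simp [below]

omit [IsStrictOrderedRing K] in
/-- Membership in `above`. [folklore] -/
theorem mem_above {F : Finset K[X]} {y z : K} : z ∈ above F y ↔ z ∈ rts F ∧ y < z := by
  simp [above]

omit [IsStrictOrderedRing K] in
/-- Two points have the same roots of the family below them iff no root separates them.
[folklore] -/
theorem below_eq_below_iff {F : Finset K[X]} {w y : K} :
    below F w = below F y ↔ ∀ z ∈ rts F, (z < w ↔ z < y) := by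
  constructor
  · intro h z hz
    constructor
    · intro hzw; exact (mem_below.mp (h ▸ mem_below.mpr ⟨hz, hzw⟩)).2
    · intro hzy; exact (mem_below.mp (h.symm ▸ mem_below.mpr ⟨hz, hzy⟩)).2
  · intro h
    ext z
    simp only [mem_below]
    exact ⟨fun hz => ⟨hz.1, (h z hz.1).mp hz.2⟩, fun hz => ⟨hz.1, (h z hz.1).mpr hz.2⟩⟩

/-- Sign of `p` at the left end of the gap of `y`: at the largest root of the family below `y`,
or at `-∞` if there is none. [folklore] -/
def sigL (F : Finset K[X]) (p : K[X]) (y : K) : SignType :=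
  if h : (below F y).Nonempty then SignType.sign (p.eval ((below F y).max' h)) else signBot p

/-- Sign of `p` at the right end of the gap of `y`: at the smallest root of the family above `y`,
or at `+∞` if there is none. [folklore] -/
def sigR (F : Finset K[X]) (p : K[X]) (y : K) : SignType :=
  if h : (above F y).Nonempty then SignType.sign (p.eval ((above F y).min' h)) else signTop p

variable [IsRealClosed K] {F : Finset K[X]} {p : K[X]}

omit [IsRealClosed K] [IsStrictOrderedRing K] in
/-- Two non-roots with the same roots below them have the same roots above them. [folklore] -/
theorem above_eq_of_below_eq {y w : K} (hy : y ∉ rts F) (hw : w ∉ rts F)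
    (h : below F w = below F y) : above F w = above F y := by
  ext z
  simp only [mem_above]
  constructor
  · rintro ⟨hz, hwz⟩
    refine ⟨hz, ?_⟩
    by_contra hzy
    have hzy' : z < y := lt_of_le_of_ne (not_lt.mp hzy) (fun h' => hy (h' ▸ hz))
    have : z ∈ below F w := h ▸ mem_below.mpr ⟨hz, hzy'⟩
    exact absurd (mem_below.mp this).2 (not_lt.mpr hwz.le)
  · rintro ⟨hz, hyz⟩
    refine ⟨hz, ?_⟩
    by_contra hzw
    have hzw' : z < w := lt_of_le_of_ne (not_lt.mp hzw) (fun h' => hw (h' ▸ hz))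
    have : z ∈ below F y := h.symm ▸ mem_below.mpr ⟨hz, hzw'⟩
    exact absurd (mem_below.mp this).2 (not_lt.mpr hyz.le)

omit [IsStrictOrderedRing K] [IsRealClosed K] in
/-- `sigL` only depends on the gap. [folklore] -/
theorem sigL_congr {y w : K} (h : below F w = below F y) : sigL F p w = sigL F p y := by
  simp only [sigL, h]

omit [IsRealClosed K] [IsStrictOrderedRing K] in
/-- `sigR` only depends on the gap (for non-roots). [folklore] -/
theorem sigR_congr {y w : K} (hy : y ∉ rts F) (hw : w ∉ rts F) (h : below F w = below F y) :
    sigR F p w = sigR F p y := by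
  simp only [sigR, above_eq_of_below_eq hy hw h]

omit [IsRealClosed K] in
/-- A common bound for the roots of the family, the roots of `p`, and the thresholds beyond which
`p` has its signs at `±∞`. [folklore] -/
theorem exists_bound (F : Finset K[X]) (p : K[X]) (hp : 0 < p.natDegree) :
    ∃ M : K, 0 < M ∧ (∀ z ∈ rts F, -M < z ∧ z < M) ∧ (∀ r, p.eval r = 0 → -M < r ∧ r < M) ∧
      (∀ x, M ≤ x → SignType.sign (p.eval x) = signTop p) ∧
      (∀ x, x ≤ -M → SignType.sign (p.eval x) = signBot p) := by
  classical
  have hp0 : p ≠ 0 := ne_zero_of_natDegree_gt hp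
  obtain ⟨T₁, hT₁⟩ := exists_forall_le_sign_eval_eq p hp
  obtain ⟨T₂, hT₂⟩ := exists_forall_ge_sign_eval_eq p hp
  set Q : Finset K := rts F ∪ p.roots.toFinset with hQ
  obtain ⟨B₁, hB₁⟩ := Finset.exists_le (Q.image fun x => |x|)
  refine ⟨max (max (B₁ + 1) 1) (max T₁ (-T₂)), ?_, ?_, ?_, ?_, ?_⟩
  · exact lt_max_of_lt_left (lt_max_of_lt_right one_pos)
  · intro z hz
    have : |z| ≤ B₁ := hB₁ _ (Finset.mem_image_of_mem _ (Finset.mem_union_left _ hz))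
    have h1 : |z| < max (max (B₁ + 1) 1) (max T₁ (-T₂)) :=
      lt_max_of_lt_left (lt_max_of_lt_left (by linarith))
    exact abs_lt.mp h1
  · intro r hr
    have hrQ : r ∈ Q := Finset.mem_union_right _
      (Multiset.mem_toFinset.mpr ((mem_roots hp0).mpr hr))
    have : |r| ≤ B₁ := hB₁ _ (Finset.mem_image_of_mem _ hrQ)
    have h1 : |r| < max (max (B₁ + 1) 1) (max T₁ (-T₂)) :=
      lt_max_of_lt_left (lt_max_of_lt_left (by linarith))
    exact abs_lt.mp h1
  · intro x hx
    exact hT₁ x (le_trans (le_max_of_le_right (le_max_left _ _)) hx)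
  · intro x hx
    refine hT₂ x ?_
    have : -T₂ ≤ max (max (B₁ + 1) 1) (max T₁ (-T₂)) := le_max_of_le_right (le_max_right _ _)
    linarith

/-- **Frame of a gap.** Around a non-root `y` of the family there is a closed interval `[a, b]`
containing `y` in its interior, containing no root of the family in its interior, on which `p` is
strictly monotone or antitone, whose endpoint signs are `sigL`, `sigR`, and which contains all
roots of `p` in the gap of `y`. Hypotheses: `p` has positive degree and the roots of `p'` are
roots of the family. [cite: BasuPollackRoy2006, Lemma 5.33 (Thom's lemma), proof] -/
theorem exists_frame (hp : 0 < p.natDegree) (hd : ∀ r, p.derivative.eval r = 0 → r ∈ rts F)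
    {y : K} (hy : y ∉ rts F) :
    ∃ a b : K, a < y ∧ y < b ∧ (∀ z ∈ rts F, ¬(a < z ∧ z < b)) ∧
      (StrictMonoOn (fun x => p.eval x) (Icc a b) ∨ StrictAntiOn (fun x => p.eval x) (Icc a b)) ∧
      SignType.sign (p.eval a) = sigL F p y ∧ SignType.sign (p.eval b) = sigR F p y ∧
      (∀ w, a < w → w < b → w ∉ rts F → below F w = below F y) ∧
      (∀ r, r ∉ rts F → p.eval r = 0 → below F r = below F y → a < r ∧ r < b) := by
  obtain ⟨M₀, hM₀, hZ, hR, hT, hB⟩ := exists_bound F p hp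
  set M : K := max M₀ (|y| + 1) with hM
  have hMM₀ : M₀ ≤ M := le_max_left _ _
  have hyM : |y| < M := lt_of_lt_of_le (by linarith) (le_max_right _ _)
  set a : K := if h : (below F y).Nonempty then (below F y).max' h else -M with ha
  set b : K := if h : (above F y).Nonempty then (above F y).min' h else M with hb
  have hay : a < y := by
    rw [ha]
    split_ifs with h
    · exact (mem_below.mp (Finset.max'_mem _ h)).2
    · have := (abs_lt.mp hyM).1; linarith
  have hyb : y < b := by
    rw [hb]
    split_ifs with h
    · exact (mem_above.mp (Finset.min'_mem _ h)).2
    · exact (abs_lt.mp hyM).2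
  have hnoZ : ∀ z ∈ rts F, ¬(a < z ∧ z < b) := by
    rintro z hz ⟨haz, hzb⟩
    rcases lt_trichotomy z y with hzy | rfl | hyz
    · have hzb' : z ∈ below F y := mem_below.mpr ⟨hz, hzy⟩
      have hne : (below F y).Nonempty := ⟨z, hzb'⟩
      have : a = (below F y).max' hne := by rw [ha, dif_pos hne]
      exact absurd (this ▸ haz) (not_lt.mpr (Finset.le_max' _ z hzb'))
    · exact hy hz
    · have hza' : z ∈ above F y := mem_above.mpr ⟨hz, hyz⟩
      have hne : (above F y).Nonempty := ⟨z, hza'⟩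
      have : b = (above F y).min' hne := by rw [hb, dif_pos hne]
      exact absurd (this ▸ hzb) (not_lt.mpr (Finset.min'_le _ z hza'))
  have hmono : StrictMonoOn (fun x => p.eval x) (Icc a b) ∨
      StrictAntiOn (fun x => p.eval x) (Icc a b) :=
    strictMonoOn_or_strictAntiOn (hay.trans hyb) fun z hz h0 => hnoZ z (hd z h0) hz
  refine ⟨a, b, hay, hyb, hnoZ, hmono, ?_, ?_, ?_, ?_⟩
  · -- sign at `a`
    rw [sigL]
    split_ifs with h
    · rw [ha, dif_pos h]
    · rw [ha, dif_neg h]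
      exact hB _ (by linarith)
  · -- sign at `b`
    rw [sigR]
    split_ifs with h
    · rw [hb, dif_pos h]
    · rw [hb, dif_neg h]
      exact hT _ hMM₀
  · -- points of `(a, b)` off the root set are in the gap of `y`
    intro w haw hwb hw
    ext z
    simp only [mem_below]
    constructor
    · rintro ⟨hz, hzw⟩
      refine ⟨hz, ?_⟩
      by_contra hzy
      have hyz : y < z := lt_of_le_of_ne (not_lt.mp hzy) fun h' => hy (h' ▸ hz)
      exact hnoZ z hz ⟨hay.trans hyz, hzw.trans hwb⟩
    · rintro ⟨hz, hzy⟩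
      refine ⟨hz, ?_⟩
      by_contra hzw
      have hwz : w < z := lt_of_le_of_ne (not_lt.mp hzw) fun h' => hw (h' ▸ hz)
      exact hnoZ z hz ⟨haw.trans hwz, hzy.trans hyb⟩
  · -- roots of `p` in the gap of `y` lie in `(a, b)`
    intro r hr hr0 hbr
    constructor
    · rw [ha]
      split_ifs with h
      · have : (below F y).max' h ∈ below F r := hbr.symm ▸ Finset.max'_mem _ h
        exact (mem_below.mp this).2
      · have := (hR r hr0).1; linarith
    · rw [hb]
      split_ifs with h
      · have hbZ : (above F y).min' h ∈ rts F := (mem_above.mp (Finset.min'_mem _ h)).1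
        have hyb' : y < (above F y).min' h := (mem_above.mp (Finset.min'_mem _ h)).2
        have hnot : (above F y).min' h ∉ below F r := by
          rw [hbr]; exact fun h' => absurd (mem_below.mp h').2 (not_lt.mpr hyb'.le)
        have hle : r ≤ (above F y).min' h := by
          by_contra hlt
          exact hnot (mem_below.mpr ⟨hbZ, not_le.mp hlt⟩)
        exact lt_of_le_of_ne hle fun h' => hr (h' ▸ hbZ)
      · exact lt_of_lt_of_le (hR r hr0).2 hMM₀

/-- **Gap lemma (C1).** A root of `p` in the gap of the non-root `y` exists iff the endpoint signs
of the gap are non-zero and opposite.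
[cite: BasuPollackRoy2006, Lemma 5.33 (Thom's lemma), proof] -/
theorem exists_root_gap_iff (hp : 0 < p.natDegree) (hd : ∀ r, p.derivative.eval r = 0 → r ∈ rts F)
    {y : K} (hy : y ∉ rts F) :
    (∃ r, r ∉ rts F ∧ below F r = below F y ∧ p.eval r = 0) ↔
      (sigL F p y = -sigR F p y ∧ sigL F p y ≠ 0) := by
  obtain ⟨a, b, hay, hyb, hnoZ, hmono, hsa, hsb, hgap, hroot⟩ := exists_frame hp hd hy
  rw [← hsa, ← hsb, ← exists_root_Ioo_iff (hay.trans hyb) hmono]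
  constructor
  · rintro ⟨r, hr, hbr, hr0⟩
    exact ⟨r, hroot r hr hr0 hbr, hr0⟩
  · rintro ⟨r, hr, hr0⟩
    have hrZ : r ∉ rts F := fun h => hnoZ r h hr
    exact ⟨r, hrZ, hgap r hr.1 hr.2 hrZ, hr0⟩

/-- **Gap lemma (C1, uniqueness).** `p` has at most one root in each gap.
[cite: BasuPollackRoy2006, Lemma 5.33 (Thom's lemma), proof] -/
theorem root_gap_unique (hp : 0 < p.natDegree) (hd : ∀ r, p.derivative.eval r = 0 → r ∈ rts F)
    {r₁ r₂ : K} (h₁ : r₁ ∉ rts F) (h₂ : r₂ ∉ rts F) (h : below F r₂ = below F r₁)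
    (hr₁ : p.eval r₁ = 0) (hr₂ : p.eval r₂ = 0) : r₁ = r₂ := by
  obtain ⟨a, b, hay, hyb, -, hmono, -, -, -, hroot⟩ := exists_frame hp hd h₁
  have := hroot r₂ h₂ hr₂ h
  exact root_unique hmono ⟨hay.le, hyb.le⟩ ⟨this.1.le, this.2.le⟩ hr₁ hr₂

/-- **Gap lemma (C2a).** Sign of `p` at a non-root `y` whose gap contains a root `r` of `p`.
[cite: BasuPollackRoy2006, Lemma 5.33 (Thom's lemma), proof] -/
theorem sign_gap_of_root (hp : 0 < p.natDegree) (hd : ∀ r, p.derivative.eval r = 0 → r ∈ rts F)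
    {y r : K} (hy : y ∉ rts F) (hy0 : p.eval y ≠ 0) (hr : r ∉ rts F) (h : below F r = below F y)
    (hr0 : p.eval r = 0) :
    SignType.sign (p.eval y) = if y < r then sigL F p y else sigR F p y := by
  obtain ⟨a, b, hay, hyb, -, hmono, hsa, hsb, -, hroot⟩ := exists_frame hp hd hy
  rw [← hsa, ← hsb]
  exact sign_eq_of_root (hay.trans hyb) hmono (hroot r hr hr0 h) hr0 ⟨hay, hyb⟩ hy0

/-- **Gap lemma (C2b).** Sign of `p` at a non-root `y` whose gap contains no root of `p`.
[cite: BasuPollackRoy2006, Lemma 5.33 (Thom's lemma), proof] -/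
theorem sign_gap_of_no_root (hp : 0 < p.natDegree)
    (hd : ∀ r, p.derivative.eval r = 0 → r ∈ rts F) {y : K} (hy : y ∉ rts F)
    (hno : ∀ r, r ∉ rts F → below F r = below F y → p.eval r ≠ 0) :
    SignType.sign (p.eval y) = if sigL F p y ≠ 0 then sigL F p y else sigR F p y := by
  obtain ⟨a, b, hay, hyb, hnoZ, hmono, hsa, hsb, hgap, -⟩ := exists_frame hp hd hy
  rw [← hsa, ← hsb]
  refine sign_eq_of_no_root (hay.trans hyb) hmono (fun r hr hr0 => ?_) ⟨hay, hyb⟩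
  have hrZ : r ∉ rts F := fun h' => hnoZ r h' hr
  exact hno r hrZ (hgap r hr.1 hr.2 hrZ) hr0

end Family

/-! ### Correspondences between two families -/

section Pairs

variable {K : Type*} [Field K] [LinearOrder K] [IsStrictOrderedRing K] [IsRealClosed K]
variable {L : Type*} [Field L] [LinearOrder L] [IsStrictOrderedRing L] [IsRealClosed L]

omit [IsRealClosed K] in
/-- A point strictly between two finite sets of reals lying one below the other. [folklore] -/
theorem exists_between_finsets (B A : Finset K) (h : ∀ b ∈ B, ∀ a ∈ A, b < a) :
    ∃ y : K, (∀ b ∈ B, b < y) ∧ (∀ a ∈ A, y < a) := by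
  by_cases hB : B.Nonempty <;> by_cases hA : A.Nonempty
  · refine ⟨(B.max' hB + A.min' hA) / 2, fun b hb => ?_, fun a ha => ?_⟩
    · have h1 : b ≤ B.max' hB := Finset.le_max' _ _ hb
      have h2 : B.max' hB < A.min' hA := h _ (Finset.max'_mem _ _) _ (Finset.min'_mem _ _)
      linarith
    · have h1 : A.min' hA ≤ a := Finset.min'_le _ _ ha
      have h2 : B.max' hB < A.min' hA := h _ (Finset.max'_mem _ _) _ (Finset.min'_mem _ _)
      linarith
  · refine ⟨B.max' hB + 1, fun b hb => ?_, fun a ha => absurd ⟨a, ha⟩ hA⟩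
    have h1 : b ≤ B.max' hB := Finset.le_max' _ _ hb
    linarith
  · refine ⟨A.min' hA - 1, fun b hb => absurd ⟨b, hb⟩ hB, fun a ha => ?_⟩
    have h1 : A.min' hA ≤ a := Finset.min'_le _ _ ha
    linarith
  · exact ⟨0, fun b hb => absurd ⟨b, hb⟩ hB, fun a ha => absurd ⟨a, ha⟩ hA⟩

/-- The family of first components of a finite family of pairs of polynomials. [folklore] -/
def fam₁ (S : Finset (K[X] × L[X])) : Finset K[X] := S.image Prod.fst

/-- The family of second components of a finite family of pairs of polynomials. [folklore] -/
def fam₂ (S : Finset (K[X] × L[X])) : Finset L[X] := S.image Prod.snd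

omit [IsStrictOrderedRing K] [IsRealClosed K] [IsStrictOrderedRing L] [IsRealClosed L] in
/-- `fam₁` of an insertion. [folklore] -/
theorem fam₁_insert (S : Finset (K[X] × L[X])) (p : K[X]) (q : L[X]) :
    fam₁ (insert (p, q) S) = insert p (fam₁ S) := by
  simp [fam₁, Finset.image_insert]

omit [IsStrictOrderedRing K] [IsRealClosed K] [IsStrictOrderedRing L] [IsRealClosed L] in
/-- `fam₂` of an insertion. [folklore] -/
theorem fam₂_insert (S : Finset (K[X] × L[X])) (p : K[X]) (q : L[X]) :
    fam₂ (insert (p, q) S) = insert q (fam₂ S) := by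
  simp [fam₂, Finset.image_insert]

omit [IsStrictOrderedRing K] [IsRealClosed K] [LinearOrder L] [IsStrictOrderedRing L] [IsRealClosed L] in
/-- First components belong to `fam₁`. [folklore] -/
theorem fst_mem_fam₁ {S : Finset (K[X] × L[X])} {pr : K[X] × L[X]} (h : pr ∈ S) : pr.1 ∈ fam₁ S :=
  Finset.mem_image_of_mem _ h

omit [LinearOrder K] [IsStrictOrderedRing K] [IsRealClosed K] [IsStrictOrderedRing L] [IsRealClosed L] in
/-- Second components belong to `fam₂`. [folklore] -/
theorem snd_mem_fam₂ {S : Finset (K[X] × L[X])} {pr : K[X] × L[X]} (h : pr ∈ S) : pr.2 ∈ fam₂ S :=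
  Finset.mem_image_of_mem _ h

omit [IsStrictOrderedRing K] [IsRealClosed K] in
/-- Root set of a family with one more member. [folklore] -/
theorem mem_rts_insert {F : Finset K[X]} {p : K[X]} {z : K} :
    z ∈ rts (insert p F) ↔ (p ≠ 0 ∧ p.eval z = 0) ∨ z ∈ rts F := by
  simp [rts, Finset.biUnion_insert, Multiset.mem_toFinset, mem_roots', IsRoot.def]

omit [IsRealClosed K] [IsStrictOrderedRing K] in
/-- Enlarging the family enlarges the root set. [folklore] -/
theorem rts_subset_rts_insert (F : Finset K[X]) (p : K[X]) : rts F ⊆ rts (insert p F) :=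
  rts_mono (Finset.subset_insert _ _)

/-- Two points `y`, `y'` occupy corresponding positions with respect to a map `e` on a finite set
`Z`: the elements of `Z` below `y` are exactly those mapped below `y'`. [folklore] -/
def Corr (e : K → L) (Z : Finset K) (y : K) (y' : L) : Prop := ∀ z ∈ Z, z < y ↔ e z < y'

/-- A **correspondence** between the two families of a finite family of pairs `S`: an
order-preserving bijection `e` from the root set of the first components onto that of the second
components, matching the signs of each pair at corresponding roots and on corresponding gaps.
This is the combinatorial content of "the two families have the same sign diagram". [folklore] -/
structure IsCorrespondence (S : Finset (K[X] × L[X])) (e : K → L) : Prop where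
  bijOn : Set.BijOn e (rts (fam₁ S)) (rts (fam₂ S))
  strictMonoOn : StrictMonoOn e (rts (fam₁ S))
  sign_root : ∀ pr ∈ S, ∀ z ∈ rts (fam₁ S),
    SignType.sign (pr.1.eval z) = SignType.sign (pr.2.eval (e z))
  sign_gap : ∀ pr ∈ S, ∀ y y', y ∉ rts (fam₁ S) → y' ∉ rts (fam₂ S) →
    Corr e (rts (fam₁ S)) y y' → SignType.sign (pr.1.eval y) = SignType.sign (pr.2.eval y')

/-- Two families of pairs have **isomorphic sign diagrams** if there is a correspondence.
[folklore] -/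
def IsoDiag (S : Finset (K[X] × L[X])) : Prop := ∃ e, IsCorrespondence S e

namespace IsCorrespondence

variable {S : Finset (K[X] × L[X])} {e : K → L}

omit [IsStrictOrderedRing K] [IsRealClosed K] [IsStrictOrderedRing L] [IsRealClosed L] in
/-- A correspondence maps roots to roots. [folklore] -/
theorem mem_of_mem (h : IsCorrespondence S e) {z : K} (hz : z ∈ rts (fam₁ S)) :
    e z ∈ rts (fam₂ S) := h.bijOn.mapsTo hz

omit [IsStrictOrderedRing K] [IsRealClosed K] [IsStrictOrderedRing L] [IsRealClosed L] in
/-- A correspondence preserves and reflects `<` on roots. [folklore] -/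
theorem lt_iff_lt (h : IsCorrespondence S e) {z w : K} (hz : z ∈ rts (fam₁ S))
    (hw : w ∈ rts (fam₁ S)) : e z < e w ↔ z < w :=
  h.strictMonoOn.lt_iff_lt hz hw

omit [IsStrictOrderedRing K] [IsRealClosed K] [IsStrictOrderedRing L] [IsRealClosed L] in
/-- A correspondence preserves and reflects `≤` on roots. [folklore] -/
theorem le_iff_le (h : IsCorrespondence S e) {z w : K} (hz : z ∈ rts (fam₁ S))
    (hw : w ∈ rts (fam₁ S)) : e z ≤ e w ↔ z ≤ w :=
  h.strictMonoOn.le_iff_le hz hw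

omit [IsStrictOrderedRing K] [IsRealClosed K] [IsRealClosed L] in
/-- Every gap of the first family corresponds to a (non-empty) gap of the second. [folklore] -/
theorem exists_corr (h : IsCorrespondence S e) (y : K) :
    ∃ y', y' ∉ rts (fam₂ S) ∧ Corr e (rts (fam₁ S)) y y' := by
  classical
  set Z := rts (fam₁ S)
  obtain ⟨y', hB, hA⟩ := exists_between_finsets ((Z.filter (· < y)).image e)
    ((Z.filter fun z => ¬z < y).image e) (by
      intro b hb a ha
      obtain ⟨zb, hzb, rfl⟩ := Finset.mem_image.mp hb
      obtain ⟨za, hza, rfl⟩ := Finset.mem_image.mp ha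
      rw [Finset.mem_filter] at hzb hza
      exact (h.lt_iff_lt hzb.1 hza.1).mpr (lt_of_lt_of_le hzb.2 (not_lt.mp hza.2)))
  refine ⟨y', fun hy' => ?_, fun z hz => ?_⟩
  · obtain ⟨z, hz, rfl⟩ := h.bijOn.surjOn hy'
    by_cases hzy : z < y
    · exact lt_irrefl _ (hB _ (Finset.mem_image_of_mem _ (Finset.mem_filter.mpr ⟨hz, hzy⟩)))
    · exact lt_irrefl _ (hA _ (Finset.mem_image_of_mem _ (Finset.mem_filter.mpr ⟨hz, hzy⟩)))
  · constructor
    · intro hzy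
      exact hB _ (Finset.mem_image_of_mem _ (Finset.mem_filter.mpr ⟨hz, hzy⟩))
    · intro hlt
      by_contra hzy
      exact lt_asymm hlt (hA _ (Finset.mem_image_of_mem _ (Finset.mem_filter.mpr ⟨hz, hzy⟩)))

omit [IsRealClosed K] [IsStrictOrderedRing L] [IsRealClosed L] in
/-- Every gap of the second family corresponds to a gap of the first. [folklore] -/
theorem exists_corr' (h : IsCorrespondence S e) (y' : L) :
    ∃ y, y ∉ rts (fam₁ S) ∧ Corr e (rts (fam₁ S)) y y' := by
  classical
  set Z := rts (fam₁ S)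
  obtain ⟨y, hB, hA⟩ := exists_between_finsets (Z.filter fun z => e z < y')
    (Z.filter fun z => ¬e z < y') (by
      intro b hb a ha
      rw [Finset.mem_filter] at hb ha
      by_contra hba
      exact ha.2 (lt_of_le_of_lt ((h.le_iff_le ha.1 hb.1).mpr (not_lt.mp hba)) hb.2))
  refine ⟨y, fun hy => ?_, fun z hz => ?_⟩
  · by_cases hzy : e y < y'
    · exact lt_irrefl _ (hB _ (Finset.mem_filter.mpr ⟨hy, hzy⟩))
    · exact lt_irrefl _ (hA _ (Finset.mem_filter.mpr ⟨hy, hzy⟩))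
  · constructor
    · intro hzy
      by_contra hzy'
      exact lt_asymm hzy (hA _ (Finset.mem_filter.mpr ⟨hz, hzy'⟩))
    · intro hzy'
      exact hB _ (Finset.mem_filter.mpr ⟨hz, hzy'⟩)

omit [IsStrictOrderedRing K] [IsRealClosed K] [IsStrictOrderedRing L] [IsRealClosed L] in
/-- Under a correspondence, the roots below corresponding points correspond. [folklore] -/
theorem below_eq_image (h : IsCorrespondence S e) {y : K} {y' : L}
    (hc : Corr e (rts (fam₁ S)) y y') :
    below (fam₂ S) y' = (below (fam₁ S) y).image e := by
  ext z'
  simp only [mem_below, Finset.mem_image]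
  constructor
  · rintro ⟨hz', hlt⟩
    obtain ⟨z, hz, rfl⟩ := h.bijOn.surjOn hz'
    exact ⟨z, ⟨hz, (hc z hz).mpr hlt⟩, rfl⟩
  · rintro ⟨z, ⟨hz, hlt⟩, rfl⟩
    exact ⟨h.mem_of_mem hz, (hc z hz).mp hlt⟩

omit [IsStrictOrderedRing K] [IsRealClosed K] [IsStrictOrderedRing L] [IsRealClosed L] in
/-- Under a correspondence, the roots above corresponding non-roots correspond. [folklore] -/
theorem above_eq_image (h : IsCorrespondence S e) {y : K} {y' : L} (hy : y ∉ rts (fam₁ S))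
    (hy' : y' ∉ rts (fam₂ S)) (hc : Corr e (rts (fam₁ S)) y y') :
    above (fam₂ S) y' = (above (fam₁ S) y).image e := by
  ext z'
  simp only [mem_above, Finset.mem_image]
  constructor
  · rintro ⟨hz', hlt⟩
    obtain ⟨z, hz, rfl⟩ := h.bijOn.surjOn hz'
    refine ⟨z, ⟨hz, ?_⟩, rfl⟩
    have h1 : ¬z < y := fun hzy => lt_asymm hlt ((hc z hz).mp hzy)
    exact lt_of_le_of_ne (not_lt.mp h1) fun h' => hy (h' ▸ hz)
  · rintro ⟨z, ⟨hz, hlt⟩, rfl⟩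
    refine ⟨h.mem_of_mem hz, ?_⟩
    have h1 : ¬e z < y' := fun h' => lt_asymm hlt ((hc z hz).mpr h')
    exact lt_of_le_of_ne (not_lt.mp h1) fun h' => hy' (h' ▸ h.mem_of_mem hz)

omit [IsStrictOrderedRing K] [IsRealClosed K] [IsStrictOrderedRing L] [IsRealClosed L] in
/-- A correspondence commutes with `max'` on sets of roots. [folklore] -/
theorem image_max' (h : IsCorrespondence S e) {B : Finset K} (hB : B ⊆ rts (fam₁ S))
    (hne : B.Nonempty) (hne' : (B.image e).Nonempty) :
    (B.image e).max' hne' = e (B.max' hne) := by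
  refine le_antisymm ?_ (Finset.le_max' _ _ (Finset.mem_image_of_mem _ (Finset.max'_mem _ _)))
  refine Finset.max'_le _ _ _ fun x hx => ?_
  obtain ⟨z, hz, rfl⟩ := Finset.mem_image.mp hx
  exact (h.le_iff_le (hB hz) (hB (Finset.max'_mem _ _))).mpr (Finset.le_max' _ _ hz)

omit [IsStrictOrderedRing K] [IsRealClosed K] [IsStrictOrderedRing L] [IsRealClosed L] in
/-- A correspondence commutes with `min'` on sets of roots. [folklore] -/
theorem image_min' (h : IsCorrespondence S e) {B : Finset K} (hB : B ⊆ rts (fam₁ S))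
    (hne : B.Nonempty) (hne' : (B.image e).Nonempty) :
    (B.image e).min' hne' = e (B.min' hne) := by
  refine le_antisymm (Finset.min'_le _ _ (Finset.mem_image_of_mem _ (Finset.min'_mem _ _))) ?_
  refine Finset.le_min' _ _ _ fun x hx => ?_
  obtain ⟨z, hz, rfl⟩ := Finset.mem_image.mp hx
  exact (h.le_iff_le (hB (Finset.min'_mem _ _)) (hB hz)).mpr (Finset.min'_le _ _ hz)

omit [IsStrictOrderedRing K] [IsRealClosed K] [IsStrictOrderedRing L] [IsRealClosed L] in
/-- **Transfer of endpoint signs (C3).** For polynomials `p`, `q` of the same degree, the same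
sign of leading coefficient and the same signs at corresponding roots, the left endpoint signs of
corresponding gaps agree. [folklore] -/
theorem sigL_eq (h : IsCorrespondence S e) {p : K[X]} {q : L[X]} (hpq : p.natDegree = q.natDegree)
    (hlc : SignType.sign p.leadingCoeff = SignType.sign q.leadingCoeff)
    (hroots : ∀ z ∈ rts (fam₁ S), SignType.sign (p.eval z) = SignType.sign (q.eval (e z)))
    {y : K} {y' : L} (hc : Corr e (rts (fam₁ S)) y y') :
    sigL (fam₂ S) q y' = sigL (fam₁ S) p y := by
  have hbe := h.below_eq_image hc
  have hsub : below (fam₁ S) y ⊆ rts (fam₁ S) := Finset.filter_subset _ _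
  unfold sigL
  by_cases hne : (below (fam₁ S) y).Nonempty
  · have hne' : (below (fam₂ S) y').Nonempty := by
      rw [hbe]; exact hne.image _
    rw [dif_pos hne', dif_pos hne]
    have : (below (fam₂ S) y').max' hne' = e ((below (fam₁ S) y).max' hne) := by
      have hne'' : ((below (fam₁ S) y).image e).Nonempty := hne.image _
      rw [← h.image_max' hsub hne hne'']
      congr 1
    rw [this, hroots _ (hsub (Finset.max'_mem _ _))]
  · have hne' : ¬(below (fam₂ S) y').Nonempty := by
      rw [hbe, Finset.image_nonempty]; exact hne
    rw [dif_neg hne', dif_neg hne]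
    simp only [signBot, hpq, hlc]

omit [IsStrictOrderedRing K] [IsRealClosed K] [IsStrictOrderedRing L] [IsRealClosed L] in
/-- **Transfer of endpoint signs (C3)**, right endpoints. [folklore] -/
theorem sigR_eq (h : IsCorrespondence S e) {p : K[X]} {q : L[X]}
    (hlc : SignType.sign p.leadingCoeff = SignType.sign q.leadingCoeff)
    (hroots : ∀ z ∈ rts (fam₁ S), SignType.sign (p.eval z) = SignType.sign (q.eval (e z)))
    {y : K} {y' : L} (hy : y ∉ rts (fam₁ S)) (hy' : y' ∉ rts (fam₂ S))
    (hc : Corr e (rts (fam₁ S)) y y') :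
    sigR (fam₂ S) q y' = sigR (fam₁ S) p y := by
  have hae := h.above_eq_image hy hy' hc
  have hsub : above (fam₁ S) y ⊆ rts (fam₁ S) := Finset.filter_subset _ _
  unfold sigR
  by_cases hne : (above (fam₁ S) y).Nonempty
  · have hne' : (above (fam₂ S) y').Nonempty := by
      rw [hae]; exact hne.image _
    rw [dif_pos hne', dif_pos hne]
    have : (above (fam₂ S) y').min' hne' = e ((above (fam₁ S) y).min' hne) := by
      have hne'' : ((above (fam₁ S) y).image e).Nonempty := hne.image _
      rw [← h.image_min' hsub hne hne'']
      congr 1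
    rw [this, hroots _ (hsub (Finset.min'_mem _ _))]
  · have hne' : ¬(above (fam₂ S) y').Nonempty := by
      rw [hae, Finset.image_nonempty]; exact hne
    rw [dif_neg hne', dif_neg hne]
    simp only [signTop, hlc]

/-- **Extension theorem** (the Cohen–Hörmander step). Let `e` be a correspondence for `S`, and
let `p`, `q` be polynomials of the same positive degree with leading coefficients of the same
sign, whose derivatives belong to the respective families, and whose signs at corresponding roots
of the families agree. Then the families extended by the pair `(p, q)` still have isomorphic sign
diagrams: on each gap `p` (resp. `q`) is strictly monotone, so its roots there and its signs
around them are dictated by the endpoint signs of the gap, which correspond.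
[cite: BasuPollackRoy2006, Lemma 5.33 (Thom's lemma), proof] -/
theorem isoDiag_insert (h : IsCorrespondence S e) {p : K[X]} {q : L[X]} (hp : 0 < p.natDegree)
    (hpq : p.natDegree = q.natDegree)
    (hlc : SignType.sign p.leadingCoeff = SignType.sign q.leadingCoeff)
    (hdp : p.derivative ∈ fam₁ S) (hdq : q.derivative ∈ fam₂ S)
    (hroots : ∀ z ∈ rts (fam₁ S), SignType.sign (p.eval z) = SignType.sign (q.eval (e z))) :
    IsoDiag (insert (p, q) S) := by
  classical
  have hq : 0 < q.natDegree := hpq ▸ hp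
  have hp0 : p ≠ 0 := ne_zero_of_natDegree_gt hp
  have hq0 : q ≠ 0 := ne_zero_of_natDegree_gt hq
  have hdp0 : p.derivative ≠ 0 := derivative_ne_zero.mpr hp.ne'
  have hdq0 : q.derivative ≠ 0 := derivative_ne_zero.mpr hq.ne'
  have hdZ : ∀ r, p.derivative.eval r = 0 → r ∈ rts (fam₁ S) := fun r hr =>
    mem_rts.mpr ⟨_, hdp, hdp0, hr⟩
  have hdZ' : ∀ r, q.derivative.eval r = 0 → r ∈ rts (fam₂ S) := fun r hr =>
    mem_rts.mpr ⟨_, hdq, hdq0, hr⟩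
  -- the new root sets
  have hZ1 : ∀ z, z ∈ rts (fam₁ (insert (p, q) S)) ↔ p.eval z = 0 ∨ z ∈ rts (fam₁ S) := by
    intro z; rw [fam₁_insert, mem_rts_insert]; simp [hp0]
  have hZ2 : ∀ z, z ∈ rts (fam₂ (insert (p, q) S)) ↔ q.eval z = 0 ∨ z ∈ rts (fam₂ S) := by
    intro z; rw [fam₂_insert, mem_rts_insert]; simp [hq0]
  -- transfer of endpoint signs
  have hL : ∀ {y y'}, Corr e (rts (fam₁ S)) y y' → sigL (fam₂ S) q y' = sigL (fam₁ S) p y :=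
    fun hc => h.sigL_eq hpq hlc hroots hc
  have hR : ∀ {y y'}, y ∉ rts (fam₁ S) → y' ∉ rts (fam₂ S) → Corr e (rts (fam₁ S)) y y' →
      sigR (fam₂ S) q y' = sigR (fam₁ S) p y :=
    fun hy hy' hc => h.sigR_eq hlc hroots hy hy' hc
  -- new roots of `p` correspond to new roots of `q`
  have hnew : ∀ y, y ∉ rts (fam₁ S) → p.eval y = 0 →
      ∃ r', r' ∉ rts (fam₂ S) ∧ Corr e (rts (fam₁ S)) y r' ∧ q.eval r' = 0 := by
    intro y hy hy0
    obtain ⟨y', hy', hc⟩ := h.exists_corr y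
    have h1 : sigL (fam₁ S) p y = -sigR (fam₁ S) p y ∧ sigL (fam₁ S) p y ≠ 0 :=
      (exists_root_gap_iff hp hdZ hy).mp ⟨y, hy, rfl, hy0⟩
    rw [← hL hc, ← hR hy hy' hc] at h1
    obtain ⟨r', hr', hbr, hr0⟩ := (exists_root_gap_iff hq hdZ' hy').mpr h1
    refine ⟨r', hr', fun z hz => ?_, hr0⟩
    rw [hc z hz]
    exact (below_eq_below_iff.mp hbr (e z) (h.mem_of_mem hz)).symm
  have hnew' : ∀ y', y' ∉ rts (fam₂ S) → q.eval y' = 0 →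
      ∃ r, r ∉ rts (fam₁ S) ∧ Corr e (rts (fam₁ S)) r y' ∧ p.eval r = 0 := by
    intro y' hy' hy0'
    obtain ⟨y, hy, hc⟩ := h.exists_corr' y'
    have h1 : sigL (fam₂ S) q y' = -sigR (fam₂ S) q y' ∧ sigL (fam₂ S) q y' ≠ 0 :=
      (exists_root_gap_iff hq hdZ' hy').mp ⟨y', hy', rfl, hy0'⟩
    rw [hL hc, hR hy hy' hc] at h1
    obtain ⟨r, hr, hbr, hr0⟩ := (exists_root_gap_iff hp hdZ hy).mpr h1
    refine ⟨r, hr, fun z hz => ?_, hr0⟩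
    rw [← hc z hz]
    exact below_eq_below_iff.mp hbr z hz
  -- at most one new root per gap
  have huniq : ∀ y' r₁ r₂, r₁ ∉ rts (fam₁ S) → r₂ ∉ rts (fam₁ S) →
      Corr e (rts (fam₁ S)) r₁ y' → Corr e (rts (fam₁ S)) r₂ y' →
      p.eval r₁ = 0 → p.eval r₂ = 0 → r₁ = r₂ := by
    intro y' r₁ r₂ h₁ h₂ hc₁ hc₂ hp₁ hp₂
    refine root_gap_unique hp hdZ h₁ h₂ (below_eq_below_iff.mpr fun z hz => ?_) hp₁ hp₂
    rw [hc₁ z hz, hc₂ z hz]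
  have huniq' : ∀ y r₁ r₂, r₁ ∉ rts (fam₂ S) → r₂ ∉ rts (fam₂ S) →
      Corr e (rts (fam₁ S)) y r₁ → Corr e (rts (fam₁ S)) y r₂ →
      q.eval r₁ = 0 → q.eval r₂ = 0 → r₁ = r₂ := by
    intro y r₁ r₂ h₁ h₂ hc₁ hc₂ hq₁ hq₂
    refine root_gap_unique hq hdZ' h₁ h₂ (below_eq_below_iff.mpr fun z' hz' => ?_) hq₁ hq₂
    obtain ⟨z, hz, rfl⟩ := h.bijOn.surjOn hz'
    rw [← hc₁ z hz, ← hc₂ z hz]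
  -- the extended map
  obtain ⟨e', he'_old, he'_new⟩ : ∃ e' : K → L, (∀ z ∈ rts (fam₁ S), e' z = e z) ∧
      (∀ y, y ∉ rts (fam₁ S) → p.eval y = 0 →
        e' y ∉ rts (fam₂ S) ∧ Corr e (rts (fam₁ S)) y (e' y) ∧ q.eval (e' y) = 0) := by
    refine ⟨fun y => if y ∈ rts (fam₁ S) then e y else
      if hex : ∃ r', r' ∉ rts (fam₂ S) ∧ Corr e (rts (fam₁ S)) y r' ∧ q.eval r' = 0
        then hex.choose else e y, fun z hz => by simp [hz], fun y hy hy0 => ?_⟩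
    have hex := hnew y hy hy0
    simp only [hy, if_false, dif_pos hex]
    exact hex.choose_spec
  -- basic order facts about `e'`
  have hmono₁ : ∀ a b, a ∈ rts (fam₁ S) → b ∉ rts (fam₁ S) → p.eval b = 0 → a < b →
      e' a < e' b := by
    intro a b ha hb hb0 hab
    rw [he'_old a ha]
    exact ((he'_new b hb hb0).2.1 a ha).mp hab
  have hmono₂ : ∀ a b, a ∉ rts (fam₁ S) → p.eval a = 0 → b ∈ rts (fam₁ S) → a < b →
      e' a < e' b := by
    intro a b ha ha0 hb hab
    rw [he'_old b hb]
    obtain ⟨haZ', hca, -⟩ := he'_new a ha ha0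
    have h1 : ¬e b < e' a := fun h' => lt_asymm hab ((hca b hb).mpr h')
    exact lt_of_le_of_ne (not_lt.mp h1) fun h' => haZ' (h' ▸ h.mem_of_mem hb)
  have hsm : StrictMonoOn e' (rts (fam₁ (insert (p, q) S)) : Set K) := by
    intro a ha b hb hab
    rw [Finset.mem_coe, hZ1] at ha hb
    by_cases haZ : a ∈ rts (fam₁ S) <;> by_cases hbZ : b ∈ rts (fam₁ S)
    · rw [he'_old a haZ, he'_old b hbZ]; exact (h.lt_iff_lt haZ hbZ).mpr hab
    · exact hmono₁ a b haZ hbZ (hb.resolve_right hbZ) hab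
    · exact hmono₂ a b haZ (ha.resolve_right haZ) hbZ hab
    · have ha0 := ha.resolve_right haZ
      have hb0 := hb.resolve_right hbZ
      by_cases hmid : ∃ z ∈ rts (fam₁ S), a < z ∧ z < b
      · obtain ⟨z, hz, haz, hzb⟩ := hmid
        exact (hmono₂ a z haZ ha0 hz haz).trans (hmono₁ z b hz hbZ hb0 hzb)
      · push Not at hmid
        exfalso
        have hbel : below (fam₁ S) b = below (fam₁ S) a := by
          refine below_eq_below_iff.mpr fun z hz => ⟨fun hzb => ?_, fun hza => hza.trans hab⟩
          by_contra hza
          have haz : a < z := lt_of_le_of_ne (not_lt.mp hza) (fun h' => haZ (h' ▸ hz))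
          exact absurd hzb (not_lt.mpr (hmid z hz haz))
        exact absurd (root_gap_unique hp hdZ haZ hbZ hbel ha0 hb0) hab.ne
  refine ⟨e', ⟨fun z hz => ?_, hsm.injOn, fun z' hz' => ?_⟩, hsm, ?_, ?_⟩
  · -- maps to
    rw [Finset.mem_coe] at hz ⊢
    rw [hZ2]
    by_cases hzZ : z ∈ rts (fam₁ S)
    · exact Or.inr (he'_old z hzZ ▸ h.mem_of_mem hzZ)
    · have hz0 : p.eval z = 0 := ((hZ1 z).mp hz).resolve_right hzZ
      exact Or.inl (he'_new z hzZ hz0).2.2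
  · -- surjective
    rw [Finset.mem_coe, hZ2] at hz'
    by_cases hzZ' : z' ∈ rts (fam₂ S)
    · obtain ⟨z, hz, rfl⟩ := h.bijOn.surjOn hzZ'
      exact ⟨z, by rw [Finset.mem_coe, hZ1]; exact Or.inr hz, he'_old z hz⟩
    · have hz0' : q.eval z' = 0 := hz'.resolve_right hzZ'
      obtain ⟨r, hr, hcr, hr0⟩ := hnew' z' hzZ' hz0'
      refine ⟨r, by rw [Finset.mem_coe, hZ1]; exact Or.inl hr0, ?_⟩
      obtain ⟨hrZ', hcr', hr0'⟩ := he'_new r hr hr0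
      exact huniq' r _ _ hrZ' hzZ' hcr' hcr hr0' hz0'
  · -- signs at roots
    intro pr hpr z hz
    rw [hZ1] at hz
    rw [Finset.mem_insert] at hpr
    by_cases hzZ : z ∈ rts (fam₁ S)
    · rw [he'_old z hzZ]
      rcases hpr with rfl | hpr
      · exact hroots z hzZ
      · exact h.sign_root pr hpr z hzZ
    · have hz0 : p.eval z = 0 := hz.resolve_right hzZ
      obtain ⟨hzZ', hcz, hz0'⟩ := he'_new z hzZ hz0
      rcases hpr with rfl | hpr
      · simp only [hz0, hz0', sign_zero]
      · exact h.sign_gap pr hpr z (e' z) hzZ hzZ' hcz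
  · -- signs on gaps
    intro pr hpr y y' hy hy' hc'
    rw [hZ1, not_or] at hy
    rw [hZ2, not_or] at hy'
    obtain ⟨hyp, hyZ⟩ := hy
    obtain ⟨hyq, hyZ'⟩ := hy'
    have hc : Corr e (rts (fam₁ S)) y y' := fun z hz => by
      rw [← he'_old z hz]; exact hc' z ((hZ1 z).mpr (Or.inr hz))
    rw [Finset.mem_insert] at hpr
    rcases hpr with rfl | hpr
    swap
    · exact h.sign_gap pr hpr y y' hyZ hyZ' hc
    · dsimp only
      by_cases hex : ∃ r, r ∉ rts (fam₁ S) ∧ below (fam₁ S) r = below (fam₁ S) y ∧ p.eval r = 0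
      · obtain ⟨r, hr, hbr, hr0⟩ := hex
        rw [sign_gap_of_root hp hdZ hyZ hyp hr hbr hr0]
        obtain ⟨hrZ', hcr, hr0'⟩ := he'_new r hr hr0
        have hbr' : below (fam₂ S) (e' r) = below (fam₂ S) y' := by
          refine below_eq_below_iff.mpr fun z' hz' => ?_
          obtain ⟨z, hz, rfl⟩ := h.bijOn.surjOn hz'
          rw [← hcr z hz, ← hc z hz]
          exact below_eq_below_iff.mp hbr z hz
        rw [sign_gap_of_root hq hdZ' hyZ' hyq hrZ' hbr' hr0', hL hc, hR hyZ hyZ' hc]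
        have h1 := hc' r ((hZ1 r).mpr (Or.inl hr0))
        have hyr : y ≠ r := fun h' => hyp (h' ▸ hr0)
        have hyr' : y' ≠ e' r := fun h' => hyq (h' ▸ hr0')
        have hiff : y < r ↔ y' < e' r := by
          constructor
          · intro hlt
            by_contra hge
            exact lt_asymm hlt (h1.mpr (lt_of_le_of_ne (not_lt.mp hge) hyr'.symm))
          · intro hlt
            by_contra hge
            exact lt_asymm hlt (h1.mp (lt_of_le_of_ne (not_lt.mp hge) hyr.symm))
        simp only [hiff]
      · push Not at hex
        rw [sign_gap_of_no_root hp hdZ hyZ hex]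
        have hex' : ∀ r', r' ∉ rts (fam₂ S) → below (fam₂ S) r' = below (fam₂ S) y' →
            q.eval r' ≠ 0 := by
          intro r' hr' hbr' hq0'
          obtain ⟨r, hr, hcr, hr0⟩ := hnew' r' hr' hq0'
          refine hex r hr ?_ hr0
          refine below_eq_below_iff.mpr fun z hz => ?_
          rw [hcr z hz, hc z hz]
          exact below_eq_below_iff.mp hbr' (e z) (h.mem_of_mem hz)
        rw [sign_gap_of_no_root hq hdZ' hyZ' hex', hL hc, hR hyZ hyZ' hc]

omit [IsStrictOrderedRing K] [IsRealClosed K] [IsRealClosed L] in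
/-- **Transfer of realized sign conditions.** Under a correspondence, every simultaneous sign
condition realized by the first components at some point is realized by the second components at
some (corresponding) point. [folklore] -/
theorem exists_sign_eq (h : IsCorrespondence S e) (y : K) :
    ∃ y', ∀ pr ∈ S, SignType.sign (pr.1.eval y) = SignType.sign (pr.2.eval y') := by
  by_cases hy : y ∈ rts (fam₁ S)
  · exact ⟨e y, fun pr hpr => h.sign_root pr hpr y hy⟩
  · obtain ⟨y', hy', hc⟩ := h.exists_corr y
    exact ⟨y', fun pr hpr => h.sign_gap pr hpr y y' hy hy' hc⟩

end IsCorrespondence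

omit [IsRealClosed K] [IsRealClosed L] [IsStrictOrderedRing K] [IsStrictOrderedRing L] in
/-- **Base case.** A family of pairs of constant polynomials with matching signs has isomorphic
sign diagrams (both root sets are empty). [folklore] -/
theorem isoDiag_of_natDegree_eq_zero {S : Finset (K[X] × L[X])}
    (h : ∀ pr ∈ S, pr.1.natDegree = 0 ∧ pr.2.natDegree = 0 ∧
      SignType.sign (pr.1.coeff 0) = SignType.sign (pr.2.coeff 0)) :
    IsoDiag S := by
  have hc : ∀ pr ∈ S, ∀ y y', SignType.sign (pr.1.eval y) = SignType.sign (pr.2.eval y') := by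
    intro pr hpr y y'
    obtain ⟨h1, h2, h3⟩ := h pr hpr
    rw [eq_C_of_natDegree_eq_zero h1, eq_C_of_natDegree_eq_zero h2, eval_C, eval_C, h3]
  have hZ1 : rts (fam₁ S) = ∅ := by
    refine Finset.eq_empty_of_forall_notMem fun z hz => ?_
    obtain ⟨f, hf, hf0, hfz⟩ := mem_rts.mp hz
    obtain ⟨pr, hpr, rfl⟩ := Finset.mem_image.mp hf
    obtain ⟨h1, -, -⟩ := h pr hpr
    rw [eq_C_of_natDegree_eq_zero h1, eval_C] at hfz
    exact hf0 (by rw [eq_C_of_natDegree_eq_zero h1, hfz, C_0])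
  have hZ2 : rts (fam₂ S) = ∅ := by
    refine Finset.eq_empty_of_forall_notMem fun z hz => ?_
    obtain ⟨f, hf, hf0, hfz⟩ := mem_rts.mp hz
    obtain ⟨pr, hpr, rfl⟩ := Finset.mem_image.mp hf
    obtain ⟨-, h2, -⟩ := h pr hpr
    rw [eq_C_of_natDegree_eq_zero h2, eval_C] at hfz
    exact hf0 (by rw [eq_C_of_natDegree_eq_zero h2, hfz, C_0])
  refine ⟨fun _ => 0, ⟨fun z hz => ?_, fun z hz => ?_, fun z hz => ?_⟩, fun a ha => ?_,
    fun pr hpr z _ => hc pr hpr z _, fun pr hpr y y' _ _ _ => hc pr hpr y y'⟩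
  · simp [hZ1] at hz
  · simp [hZ1] at hz
  · simp [hZ2] at hz
  · simp [hZ1] at ha

omit [IsStrictOrderedRing K] [IsRealClosed K] [IsRealClosed L] in
/-- Realized sign conditions transfer along isomorphic sign diagrams. [folklore] -/
theorem IsoDiag.exists_sign_eq {S : Finset (K[X] × L[X])} (h : IsoDiag S) (y : K) :
    ∃ y', ∀ pr ∈ S, SignType.sign (pr.1.eval y) = SignType.sign (pr.2.eval y') := by
  obtain ⟨e, he⟩ := h
  exact he.exists_sign_eq y

end Pairs

/-! ### Parametric sign diagrams (Cohen–Hörmander method) -/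

section Param

variable {A : Type*} [CommRing A]
variable {K : Type*} [Field K] [LinearOrder K] [IsStrictOrderedRing K] [IsRealClosed K]
variable {L : Type*} [Field L] [LinearOrder L] [IsStrictOrderedRing L] [IsRealClosed L]

omit [IsRealClosed K] in
/-- Sign bookkeeping: if `w = c ^ D * v` with `c ≠ 0` then `sign v = (sign c) ^ D * sign w`.
[folklore] -/
theorem sign_eq_of_eq_pow_mul {c v w : K} {D : ℕ} (hc : c ≠ 0) (h : w = c ^ D * v) :
    SignType.sign v = SignType.sign c ^ D * SignType.sign w := by
  have hpos : 0 < c ^ D * c ^ D := mul_self_pos.mpr (pow_ne_zero D hc)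
  calc SignType.sign v = SignType.sign (c ^ D * c ^ D * v) := by
        rw [sign_mul (c ^ D * c ^ D), sign_pos hpos, one_mul]
    _ = SignType.sign (c ^ D * w) := by rw [h, mul_assoc]
    _ = SignType.sign c ^ D * SignType.sign w := by rw [sign_mul, sign_pow]

/-- The finite family of pairs of specializations of a family `P ⊆ A[X]` under two ring
homomorphisms `φ : A → K`, `ψ : A → L` into two real closed fields.
[cite: BasuPollackRoy2006, §1.3, Notation 1.18 (specialization Q_y), p. 22] -/
def specPairs (P : Finset A[X]) (φ : A →+* K) (ψ : A →+* L) : Finset (K[X] × L[X]) :=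
  P.image fun f => (f.map φ, f.map ψ)

omit [IsStrictOrderedRing K] [IsRealClosed K] [IsStrictOrderedRing L] [IsRealClosed L] in
/-- Members of `P` give pairs of specializations.
[cite: BasuPollackRoy2006, §1.3, Notation 1.18 (specialization Q_y), p. 22] -/
theorem mem_specPairs {P : Finset A[X]} {φ : A →+* K} {ψ : A →+* L} {f : A[X]} (hf : f ∈ P) :
    (f.map φ, f.map ψ) ∈ specPairs P φ ψ :=
  Finset.mem_image_of_mem _ hf

omit [IsStrictOrderedRing K] [IsRealClosed K] [IsStrictOrderedRing L] [IsRealClosed L] in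
/-- The first components of `specPairs P φ ψ` are the `φ`-specializations.
[cite: BasuPollackRoy2006, §1.3, Notation 1.18 (specialization Q_y), p. 22] -/
theorem fam₁_specPairs (P : Finset A[X]) (φ : A →+* K) (ψ : A →+* L) :
    fam₁ (specPairs P φ ψ) = P.image fun f => f.map φ := by
  rw [fam₁, specPairs, Finset.image_image]; rfl

omit [IsStrictOrderedRing K] [IsRealClosed K] [IsStrictOrderedRing L] [IsRealClosed L] in
/-- The second components of `specPairs P φ ψ` are the `ψ`-specializations.
[cite: BasuPollackRoy2006, §1.3, Notation 1.18 (specialization Q_y), p. 22] -/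
theorem fam₂_specPairs (P : Finset A[X]) (φ : A →+* K) (ψ : A →+* L) :
    fam₂ (specPairs P φ ψ) = P.image fun f => f.map ψ := by
  rw [fam₂, specPairs, Finset.image_image]; rfl

omit [IsStrictOrderedRing K] [IsRealClosed K] [IsStrictOrderedRing L] [IsRealClosed L] in
/-- `specPairs` of an insertion.
[cite: BasuPollackRoy2006, §1.3, Notation 1.18 (specialization Q_y), p. 22] -/
theorem specPairs_insert [DecidableEq A] (P : Finset A[X]) (φ : A →+* K) (ψ : A →+* L) (p : A[X]) :
    specPairs (insert p P) φ ψ = insert (p.map φ, p.map ψ) (specPairs P φ ψ) := by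
  rw [specPairs, Finset.image_insert]; rfl

omit [IsRealClosed K] [IsRealClosed L] in
/-- **Root transfer.** In the inductive step (removing a member `p` of maximal positive degree from
a stable family `P`), the signs of the two specializations of `p` agree at corresponding roots of
the smaller families: at a root `z` of `g_φ` (`g ∈ P ∖ {p}`, normalized so that its leading
coefficient does not vanish under `φ`), the pseudo-remainder identity expresses `p_φ(z)` through
the specialization of `sprem p g`, a member of `P ∖ {p}`.
[cite: BasuPollackRoy2006, §1.3, Notation 1.18 (specialization Q_y), p. 22] -/
theorem sign_map_eval_eq_of_mem_rts [DecidableEq A] {P : Finset A[X]} (hP : SignDiagram.IsStable P)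
    {φ : A →+* K} {ψ : A →+* L}
    (hsign : ∀ f ∈ P, ∀ i, SignType.sign (φ (f.coeff i)) = SignType.sign (ψ (f.coeff i)))
    {p : A[X]} (hpP : p ∈ P) (hd : 0 < p.natDegree) (hmax : ∀ f ∈ P, f.natDegree ≤ p.natDegree)
    {e : K → L} (he : IsCorrespondence (specPairs (P.erase p) φ ψ) e)
    {z : K} (hz : z ∈ rts (fam₁ (specPairs (P.erase p) φ ψ))) :
    SignType.sign ((p.map φ).eval z) = SignType.sign ((p.map ψ).eval (e z)) := by
  set P' := P.erase p with hP'def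
  have hP'sub : ∀ f ∈ P', f ∈ P := fun f hf => Finset.mem_of_mem_erase hf
  have hP' : SignDiagram.IsStable P' := hP.erase hd hmax
  -- a member `g ∈ P'` with `g_φ ≠ 0`, `g_φ(z) = 0`, normalized
  obtain ⟨F, hF, hF0, hFz⟩ := mem_rts.mp hz
  rw [fam₁_specPairs] at hF
  obtain ⟨g, hgP', rfl⟩ := Finset.mem_image.mp hF
  obtain ⟨g', hg'P', hmap, hlc, hdeg⟩ := hP'.exists_map_eq φ hgP' hF0
  have hg'P : g' ∈ P := hP'sub g' hg'P'
  have hm : 0 < g'.natDegree := by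
    rw [← natDegree_map_of_leadingCoeff_ne_zero φ hlc, hmap]
    exact natDegree_pos_iff_degree_pos.mpr (degree_pos_of_root hF0 hFz)
  have hmp : g'.natDegree ≤ p.natDegree := hdeg.trans (hmax g (hP'sub g hgP'))
  have hlt : (SignDiagram.sprem p g').natDegree < p.natDegree := (SignDiagram.natDegree_sprem_lt hm).trans_le hmp
  have hSP' : SignDiagram.sprem p g' ∈ P' :=
    Finset.mem_erase.mpr ⟨fun h => lt_irrefl _ (h ▸ hlt), hP.sprem_mem hpP hg'P hm hmp⟩
  -- signs of the leading coefficient of `g'`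
  have hslc : SignType.sign (φ g'.leadingCoeff) = SignType.sign (ψ g'.leadingCoeff) := by
    have := hsign g' hg'P g'.natDegree
    rwa [coeff_natDegree] at this
  have hlcψ : ψ g'.leadingCoeff ≠ 0 := by
    intro h0
    rw [h0, sign_zero, sign_eq_zero_iff] at hslc
    exact hlc hslc
  -- `z` and `e z` are roots of the specializations of `g'`
  have hzφ : g'.eval₂ φ z = 0 := by rw [← eval_map, hmap]; exact hFz
  have hzψ : g'.eval₂ ψ (e z) = 0 := by
    have h1 := he.sign_root _ (mem_specPairs hg'P') z hz
    dsimp only at h1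
    rw [hmap, hFz, sign_zero, eq_comm, sign_eq_zero_iff, eval_map] at h1
    exact h1
  -- pseudo-remainder identities and the correspondence for `sprem p g'`
  have hidφ := SignDiagram.eval₂_sprem φ (p := p) hm hzφ
  have hidψ := SignDiagram.eval₂_sprem ψ (p := p) hm hzψ
  have h2 := he.sign_root _ (mem_specPairs hSP') z hz
  dsimp only at h2
  rw [eval_map, eval_map] at h2
  rw [eval_map, eval_map, sign_eq_of_eq_pow_mul hlc hidφ, sign_eq_of_eq_pow_mul hlcψ hidψ, h2, hslc]

/-- **Parametric sign-diagram theorem** (Cohen–Hörmander, in Muchnik's form). Let `P ⊆ A[X]` be a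
finite stable family and `φ : A → K`, `ψ : A → L` two ring homomorphisms into real closed fields
giving the same sign to every
coefficient of every member of `P`. Then the specialized families `{f_φ}` and `{f_ψ}` have
isomorphic sign diagrams. Induction on `P`, removing a member of maximal degree.
[Bochnak–Coste–Roy 1998, proof of Thm. 2.2.1 / §1.4; Michaux–Ozturk 2002]
[cite: BasuPollackRoy2006, Lemma 2.74 and Thm. 2.76] -/
theorem isoDiag_specPairs (φ : A →+* K) (ψ : A →+* L) (P : Finset A[X]) (hP : SignDiagram.IsStable P)
    (hsign : ∀ f ∈ P, ∀ i, SignType.sign (φ (f.coeff i)) = SignType.sign (ψ (f.coeff i))) :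
    IsoDiag (specPairs P φ ψ) := by
  classical
  induction P using Finset.strongInduction with
  | H P ih =>
    by_cases hpos : ∃ f ∈ P, 0 < f.natDegree
    · obtain ⟨f₀, hf₀, hf₀d⟩ := hpos
      obtain ⟨p, hpP, hmax⟩ := Finset.exists_max_image P natDegree ⟨f₀, hf₀⟩
      have hd : 0 < p.natDegree := hf₀d.trans_le (hmax f₀ hf₀)
      set P' := P.erase p with hP'def
      have hP' : SignDiagram.IsStable P' := hP.erase hd hmax
      have hsub : P' ⊂ P := Finset.erase_ssubset hpP
      have hsign' : ∀ f ∈ P', ∀ i,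
          SignType.sign (φ (f.coeff i)) = SignType.sign (ψ (f.coeff i)) :=
        fun f hf i => hsign f (Finset.mem_of_mem_erase hf) i
      obtain ⟨e, he⟩ := ih P' hsub hP' hsign'
      have hPins : specPairs P φ ψ = insert (p.map φ, p.map ψ) (specPairs P' φ ψ) := by
        rw [← specPairs_insert, Finset.insert_erase hpP]
      rw [hPins]
      have hslc : SignType.sign (φ p.leadingCoeff) = SignType.sign (ψ p.leadingCoeff) := by
        have := hsign p hpP p.natDegree
        rwa [coeff_natDegree] at this
      by_cases hlc : φ p.leadingCoeff = 0
      · -- the leading coefficient vanishes under both specializations: `p` specializes like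
        -- `eraseLead p ∈ P'`
        have hlc' : ψ p.leadingCoeff = 0 := by
          rw [hlc, sign_zero, eq_comm, sign_eq_zero_iff] at hslc; exact hslc
        have hE : eraseLead p ∈ P' := by
          refine Finset.mem_erase.mpr ⟨fun h => ?_, hP.eraseLead_mem hpP⟩
          rcases eraseLead_natDegree_lt_or_eraseLead_eq_zero p with hlt | h0
          · rw [h] at hlt; exact lt_irrefl _ hlt
          · rw [h0] at h; rw [← h] at hd; simp at hd
        have hmem := mem_specPairs (φ := φ) (ψ := ψ) hE
        rw [SignDiagram.map_eraseLead_of_apply_leadingCoeff φ hlc,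
          SignDiagram.map_eraseLead_of_apply_leadingCoeff ψ hlc'] at hmem
        rw [Finset.insert_eq_of_mem hmem]
        exact ⟨e, he⟩
      · have hlcψ : ψ p.leadingCoeff ≠ 0 := by
          intro h0
          rw [h0, sign_zero, sign_eq_zero_iff] at hslc
          exact hlc hslc
        have hder : derivative p ∈ P' := by
          refine Finset.mem_erase.mpr ⟨fun h => ?_, hP.derivative_mem hpP⟩
          have := natDegree_derivative_lt hd.ne'
          rw [h] at this
          exact lt_irrefl _ this
        refine he.isoDiag_insert ?_ ?_ ?_ ?_ ?_ ?_
        · rw [natDegree_map_of_leadingCoeff_ne_zero φ hlc]; exact hd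
        · rw [natDegree_map_of_leadingCoeff_ne_zero φ hlc,
            natDegree_map_of_leadingCoeff_ne_zero ψ hlcψ]
        · rw [leadingCoeff_map_of_leadingCoeff_ne_zero φ hlc,
            leadingCoeff_map_of_leadingCoeff_ne_zero ψ hlcψ, hslc]
        · rw [derivative_map, fam₁_specPairs]
          exact Finset.mem_image_of_mem _ hder
        · rw [derivative_map, fam₂_specPairs]
          exact Finset.mem_image_of_mem _ hder
        · intro z hz
          exact sign_map_eval_eq_of_mem_rts hP hsign hpP hd hmax he hz
    · push Not at hpos
      refine isoDiag_of_natDegree_eq_zero fun pr hpr => ?_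
      obtain ⟨f, hf, rfl⟩ := Finset.mem_image.mp hpr
      have hf0 : f.natDegree = 0 := Nat.le_zero.mp (hpos f hf)
      refine ⟨Nat.le_zero.mp (natDegree_map_le.trans hf0.le),
        Nat.le_zero.mp (natDegree_map_le.trans hf0.le), ?_⟩
      dsimp only
      rw [coeff_map, coeff_map]
      exact hsign f hf 0

/-- **Transfer of realizable sign conditions.** Under the hypotheses of `isoDiag_specPairs`, every
simultaneous sign condition on the members of `P` realized by the `φ`-specializations at some real
point is realized by the `ψ`-specializations at some real point.
[cite: BasuPollackRoy2006, Lemma 2.74 and Thm. 2.76] -/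
theorem exists_forall_sign_eval_map_eq (φ : A →+* K) (ψ : A →+* L) (P : Finset A[X]) (hP : SignDiagram.IsStable P)
    (hsign : ∀ f ∈ P, ∀ i, SignType.sign (φ (f.coeff i)) = SignType.sign (ψ (f.coeff i)))
    (y : K) : ∃ y', ∀ f ∈ P,
      SignType.sign ((f.map φ).eval y) = SignType.sign ((f.map ψ).eval y') := by
  obtain ⟨y', hy'⟩ := (isoDiag_specPairs φ ψ P hP hsign).exists_sign_eq y
  exact ⟨y', fun f hf => hy' _ (mem_specPairs hf)⟩

end Param

end SignDiagramRCF

end Literature.ModelTheory.ExponentialFields
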